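import Summits.ResolutionOfSingularities.ResolutionOfSingularities.Theorems.DominanceDivisorCutPrincipalization
import HarnessLib

/-!
# DominanceDivisorCut — the decomp-res node «DivisorCut» (lens-3 g6): split beneath `LogResDiv`, Nagata step,
`closes`

Source HOME/decomp-res-lens-3/g6/DivisorCut.lean (sha256 9d24df0e1bf5399f), CRITIC-LEDGER row 39: CLEARED AS ATTACK
NODE on
`Dominance.SandwichedResolveProper` (24574); pieces = Dominance rev 8 asides 29715–29721 (tags in their docstrings
and in
`Theorems/DominanceDivisorCutPrincipalization.lean`).  Kernels here (0 sorry):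
* `logResDiv_of_embDesing_endGame` : `EmbDesingDiv` 29720 → `EndGameDiv` 29721 → `LogResDiv` 29715 (the split
beneath the
  open piece: embedded desingularization WITHOUT transversality + the END GAME one dimension down; `EndGameDiv₄` is
  ATTACKABLE closed-modulo-library = prover target #4 of the cell, census ask T-endgame);
* `hasResolution_sandwiched_of_proper`, `properReduction_of_nagata` : the Nagata step `ProperReduction` 29719
  (24574 → 24572) PROVED modulo the tree's named fact `NagataCompactification`;
* `closes` : ROOT ⟸ `Dominance.RegularRoofs` ∧ `ProperReduction` ∧ `IdealsAreSumsOfDivisors` ∧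
`MonomialPrincipalization` ∧
  `LogResDiv` through `Dominance.closes` BY NAME; `closes_split` (with the split beneath), `closes_nagata` (Nagata
fact
  in place of `ProperReduction`).  Implication node; exactness is not claimed (LogResDiv / EmbDesingDiv are sufficient
  rungs whose necessity from S is unknown — declared).
[DeJong1996 §4; Kollar2007 Thm. 3.35; CossartJannsenSaito2020 Thm. 1.4; CossartPiltant2019 Prop. 4.4]
-/

noncomputable section

namespace Summit.ResolutionOfSingularities.ResolutionOfSingularities.Theorems.DominanceDivisorCut

open CategoryTheory CategoryTheory.Limits AlgebraicGeometry TopologicalSpace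
open Literature.AlgebraicGeometry.Resolution Literature.AlgebraicGeometry.Morphisms
open Summit.ResolutionOfSingularities.ResolutionOfSingularities.Theses
open Summit.ResolutionOfSingularities.ResolutionOfSingularities.Theorems
open Summit.ResolutionOfSingularities.ResolutionOfSingularities.Theorems.DominanceDivisorCutPrincipalization

/-! ## Kernel 3: the split beneath `LogResDiv` -/

/-- **Log resolution ⟸ embedded desingularization ∧ end game.** PROVED (Temkin's composition
lemma with `T = ⋃ Supp Dᵢ`). [cite: Temkin2008, Lemma 2.1.4] -/
theorem logResDiv_of_embDesing_endGame (hE : Dominance.EmbDesingDiv) (hF : Dominance.EndGameDiv) :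
    Dominance.LogResDiv := by
  intro p hp k _ _ Y g hg₁ hg₂ hg₃ hY hYreg n D hD
  haveI := hg₁; haveI := hg₂; haveI := hg₃; haveI := hY
  haveI : IsLocallyNoetherian Y := LocallyOfFiniteType.isLocallyNoetherian g
  haveI : CompactSpace Y := QuasiCompact.compactSpace_of_compactSpace g
  haveI : IsNoetherian Y := {}
  set T : Set Y := ⋃ i, ((D i).support : Set Y) with hT
  have hξ : genericPoint Y ∉ T := by
    simp only [hT, Set.mem_iUnion, not_exists]
    exact fun i => genericPoint_not_mem_support (hD i)
  obtain ⟨Q₁, Y₁, π, X, B, hQ₁, hπ, hreg₁, hX, hXreg, hB, hpre⟩ :=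
    hE p hp k Y g hg₁ hg₂ hg₃ hY hYreg n D hD
  haveI := hπ.isProper
  have hQ₁ne : Q₁ ≠ ⊥ := by
    intro h
    apply hξ
    apply hQ₁
    rw [h, Scheme.IdealSheafData.support_bot]
    trivial
  haveI : IsIntegral Y₁ := hπ.isIntegral hQ₁ne
  obtain ⟨Q₂, Y₂, π', hQ₂, hπ', hreg₂, hsnc⟩ :=
    hF p hp k Y₁ (π ≫ g) inferInstance inferInstance inferInstance inferInstance hreg₁ X B hX
      hXreg hB
  have hQ₂T : (Q₂.support : Set Y₁) ⊆ π ⁻¹' T := by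
    intro y hy
    show y ∈ π ⁻¹' T
    rw [hpre]
    exact Or.inl (hQ₂ hy).1
  obtain ⟨Q, hQ, hQT⟩ := hπ.exists_isBlowup_comp_supported π Q₁ π' Q₂ T hQ₁ hπ' hQ₂T
  refine ⟨Q, Y₂, π' ≫ π, hQT, hQ, hreg₂, ?_⟩
  have hcomp : ((π' ≫ π) ⁻¹' T) = π' ⁻¹' ((X.support : Set Y₁) ∪ B) := by
    rw [← hpre]
    ext y
    simp only [Set.mem_preimage, Scheme.Hom.comp_apply, hT]
  rw [hcomp]
  exact hsnc

/-! ## Kernel 4: the Nagata step `ProperReduction`, PROVED modulo the named fact `NagataCompactification` -/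

/-- **An integral scheme sandwiched (separated, of finite type, birationally) over an integral
regular base is resolved once proper sandwiches are**: compactify `b : Γ → Y` to a proper
`c : Γ̄ → Y` with `Γ̄` integral (Nagata over a field + graph closure, tree
`DominanceOfTwoModelPatching.exists_integral_compactification_over`); `c` is birational because
over the dense open `U` where `b` is an isomorphism the section `U ≅ b⁻¹U ↪ c⁻¹U` is an open AND
closed immersion (a section of a separated morphism) into an irreducible scheme, hence an
isomorphism; a resolution of `Γ̄` restricts to one of the open `Γ`. [cite: Conrad2007, Thm. 4.1] -/
theorem hasResolution_sandwiched_of_proper (hN : NagataCompactification.{0})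
    (hSP : Dominance.SandwichedResolveProper) {p : ℕ} (hp : p.Prime) {k : Type} [Field k]
    [CharP k p] {Y : Scheme.{0}} (g : Y ⟶ Spec (.of k)) [IsSeparated g] [LocallyOfFiniteType g]
    [QuasiCompact g] [IsIntegral Y] (hY : Scheme.IsRegular Y) {Γ : Scheme.{0}} (b : Γ ⟶ Y)
    [IsSeparated b] [LocallyOfFiniteType b] [QuasiCompact b] [IsIntegral Γ]
    (hb : IsBirational b) : Scheme.HasResolution Γ := by
  have hNk := nagata_over_field_of_nagataCompactification hN k
  obtain ⟨Γb, jΓ, c, hΓb, hjΓ, hc, hfac⟩ :=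
    DominanceOfTwoModelPatching.exists_integral_compactification_over hNk g b
  haveI := hΓb; haveI := hjΓ; haveI := hc
  subst hfac
  obtain ⟨U, hUd, hbUd, hUiso⟩ := hb
  haveI := hUiso
  -- the section `e : b⁻¹U → c⁻¹U`, `e ≫ (c ∣_ U) = b ∣_ U` an isomorphism
  let e := jΓ ∣_ (c ⁻¹ᵁ U)
  have he : e ≫ (c ∣_ U) = (jΓ ≫ c) ∣_ U := (morphismRestrict_comp jΓ c U).symm
  haveI hiso : IsIso (e ≫ (c ∣_ U)) := by rw [he]; exact hUiso
  haveI : IsClosedImmersion (e ≫ (c ∣_ U)) := inferInstance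
  haveI : IsClosedImmersion e := IsClosedImmersion.of_comp e (c ∣_ U)
  -- `c⁻¹U` is irreducible (a non-empty open of the integral `Γ̄`) and `b⁻¹U` is non-empty
  obtain ⟨x₀, hx₀⟩ := hbUd.nonempty
  have hx₀' : jΓ x₀ ∈ c ⁻¹ᵁ U := by
    show c (jΓ x₀) ∈ U
    have : (jΓ ≫ c) x₀ ∈ U := hx₀
    rwa [Scheme.Hom.comp_apply] at this
  have hirr : IsIrreducible ((c ⁻¹ᵁ U : Γb.Opens) : Set Γb) :=
    ⟨⟨_, hx₀'⟩, (IrreducibleSpace.isIrreducible_univ Γb).isPreirreducible.open_subset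
      (c ⁻¹ᵁ U).isOpen (Set.subset_univ _)⟩
  haveI : IrreducibleSpace ((c ⁻¹ᵁ U : Γb.Opens) : Scheme.{0}) := Subtype.irreducibleSpace hirr
  haveI : PreconnectedSpace ((c ⁻¹ᵁ U : Γb.Opens) : Scheme.{0}) :=
    ⟨(IrreducibleSpace.isIrreducible_univ _).isPreirreducible.isPreconnected⟩
  have hne : (Set.range e).Nonempty := by
    have hx₀'' : x₀ ∈ jΓ ⁻¹ᵁ (c ⁻¹ᵁ U) := hx₀'
    haveI : Nonempty ((jΓ ⁻¹ᵁ (c ⁻¹ᵁ U) : Γ.Opens) : Scheme.{0}) := ⟨⟨x₀, hx₀''⟩⟩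
    exact Set.range_nonempty _
  have hrange : Set.range e = Set.univ :=
    IsClopen.eq_univ ⟨e.isClosedEmbedding.isClosed_range, e.isOpenEmbedding.isOpen_range⟩ hne
  haveI : IsIso e := by
    apply isIso_of_isOpenImmersion_of_opensRange_eq_top
    exact TopologicalSpace.Opens.ext (by simpa using hrange)
  haveI : IsIso (c ∣_ U) := IsIso.of_isIso_comp_left e (c ∣_ U)
  have hcbir : IsBirational c := by
    refine ⟨U, hUd, ?_, inferInstance⟩
    exact (c ⁻¹ᵁ U).isOpen.dense ⟨_, hx₀'⟩
  -- resolve the proper sandwich and restrict over `Γ ≅ jΓ.opensRange`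
  obtain ⟨N, π, hπ⟩ := hSP p hp k Y g ‹_› ‹_› ‹_› ‹_› hY Γb c hΓb hc hcbir
  haveI := hπ.isProper
  let V : N.Opens := π ⁻¹ᵁ jΓ.opensRange
  have hVreg : Scheme.IsRegular (V : Scheme.{0}) := hπ.isRegular.of_isOpenImmersion V.ι
  have hres : Scheme.HasResolution (jΓ.opensRange : Scheme.{0}) :=
    ⟨(V : Scheme.{0}), π ∣_ jΓ.opensRange,
      ⟨inferInstance, hπ.isBirational.morphismRestrict _, hVreg⟩⟩
  exact Scheme.HasResolution.of_iso (Scheme.Hom.isoOpensRange jΓ).inv hres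

/-- **`ProperReduction` modulo Nagata** (item 24572 from its proper form 24574): the regular base
is the disjoint union of its clopen irreducible components
(`Scheme.IsRegular.coe_irreducibleComponentOpen`); over each the sandwiched scheme is integral
and resolved by `hasResolution_sandwiched_of_proper`; the pieces glue along the clopen
decomposition (`DominanceOfTwoModelPatching.hasResolution_sup_of_disjoint`).  PROVED (the
component bookkeeping is copied from `sandwichedResolve_of_twoModelPatching`).
[cite: Conrad2007, Thm. 4.1] -/
theorem properReduction_of_nagata (hN : NagataCompactification.{0}) : Dominance.ProperReduction := by
  classical
  intro hSP p hp k _ _ Y g hg1 hg2 hg3 hY Γ b hb1 hb2 hb3 hbb hΓ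
  haveI := hg1; haveI := hg2; haveI := hg3; haveI := hb1; haveI := hb2; haveI := hb3; haveI := hΓ
  haveI : IsLocallyNoetherian Y := LocallyOfFiniteType.isLocallyNoetherian g
  haveI : CompactSpace Y := QuasiCompact.compactSpace_of_compactSpace g
  haveI : IsNoetherian Y := {}
  haveI : IsReduced Y := hY.isReduced
  let YC : Set Y → Y.Opens := fun C => Y.irreducibleComponentOpen C
  have hcoe : ∀ C ∈ irreducibleComponents Y, ((YC C : Y.Opens) : Set Y) = C := fun C hC =>
    hY.coe_irreducibleComponentOpen hC
  -- resolution over one component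
  have hone : ∀ C ∈ irreducibleComponents Y,
      Scheme.HasResolution ((b ⁻¹ᵁ (YC C) : Γ.Opens) : Scheme) := by
    intro C hC
    have hirr : IsIrreducible ((YC C : Y.Opens) : Set Y) := by
      rw [hcoe C hC]
      exact hC.1
    haveI : IrreducibleSpace ((YC C : Y.Opens) : Scheme) := Subtype.irreducibleSpace hirr
    haveI : IsIntegral ((YC C : Y.Opens) : Scheme) :=
      isIntegral_of_irreducibleSpace_of_isReduced _
    have hYC : Scheme.IsRegular ((YC C : Y.Opens) : Scheme) := hY.of_isOpenImmersion (YC C).ι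
    have hbC : IsBirational (b ∣_ (YC C)) := hbb.morphismRestrict _
    haveI : IrreducibleSpace ((b ⁻¹ᵁ (YC C) : Γ.Opens) : Scheme) :=
      ComponentGluing.IsBirational.irreducibleSpace hbC
    haveI : IsIntegral ((b ⁻¹ᵁ (YC C) : Γ.Opens) : Scheme) :=
      isIntegral_of_irreducibleSpace_of_isReduced _
    exact hasResolution_sandwiched_of_proper hN hSP hp ((YC C).ι ≫ g) hYC (b ∣_ (YC C)) hbC
  -- induction over finite sets of components
  have key : ∀ S : Finset (Set Y), (↑S : Set (Set Y)) ⊆ irreducibleComponents Y →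
      Scheme.HasResolution ((b ⁻¹ᵁ (⨆ C ∈ S, YC C) : Γ.Opens) : Scheme) := by
    intro S
    induction S using Finset.induction_on with
    | empty =>
      intro _
      have e : (⨆ C ∈ (∅ : Finset (Set Y)), YC C : Y.Opens) = ⊥ := by simp
      rw [e, Scheme.Hom.preimage_bot]
      apply Scheme.IsRegular.hasResolution
      intro x
      have hx : x.1 ∈ ((⊥ : Γ.Opens) : Set Γ) := x.2
      rw [Opens.coe_bot] at hx
      exact (Set.notMem_empty _ hx).elim
    | insert C S hCS ih =>
      intro hsub
      have hC : C ∈ irreducibleComponents Y := hsub (Finset.mem_insert_self C S)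
      have hS : (↑S : Set (Set Y)) ⊆ irreducibleComponents Y := fun D hD =>
        hsub (Finset.mem_insert_of_mem hD)
      rw [Finset.iSup_insert, Scheme.Hom.preimage_sup]
      refine DominanceOfTwoModelPatching.hasResolution_sup_of_disjoint _ _ ?_ (hone C hC) (ih hS)
      rw [← Opens.coe_disjoint]
      refine Set.disjoint_left.mpr fun x hx hx' => ?_
      have h1 : b x ∈ (YC C : Y.Opens) := hx
      have h2 : b x ∈ ((⨆ D ∈ S, YC D : Y.Opens) : Set Y) := hx'
      simp only [Opens.coe_iSup, Set.mem_iUnion] at h2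
      obtain ⟨D, hD, h2⟩ := h2
      have hDc : D ∈ irreducibleComponents Y := hS hD
      have e1 : b x ∈ C := by rw [← hcoe C hC]; exact h1
      have e2 : b x ∈ D := by rw [← hcoe D hDc]; exact h2
      have := hY.eq_of_mem_irreducibleComponents (b x) hC hDc e1 e2
      exact hCS (this ▸ hD)
  have hfin : (irreducibleComponents Y).Finite := NoetherianSpace.finite_irreducibleComponents
  have htop : (⨆ C ∈ hfin.toFinset, YC C : Y.Opens) = ⊤ := by
    refine top_le_iff.mp fun y _ => ?_
    simp only [Opens.mem_iSup]
    refine ⟨irreducibleComponent y, hfin.mem_toFinset.mpr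
      (irreducibleComponent_mem_irreducibleComponents y), ?_⟩
    show y ∈ ((YC (irreducibleComponent y) : Y.Opens) : Set Y)
    rw [hcoe _ (irreducibleComponent_mem_irreducibleComponents y)]
    exact mem_irreducibleComponent
  have hall := key hfin.toFinset fun C hC => hfin.mem_toFinset.mp hC
  have htop' : (b ⁻¹ᵁ (⨆ C ∈ hfin.toFinset, YC C) : Γ.Opens) = ⊤ := by
    rw [htop, Scheme.Hom.preimage_top]
  have hall' : Scheme.HasResolution ((⊤ : Γ.Opens) : Scheme) := by
    rw [← htop']
    exact hall
  exact Scheme.HasResolution.of_iso Γ.topIso.hom hall'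

/-! ## The node: ROOT ⟸ pieces, through `Dominance.closes` BY NAME -/

/-- **`closes`**: the ROOT from the certified-weaker half `Dominance.RegularRoofs` (stmt-24573),
the Nagata step `ProperReduction`, the two textbook/port supports and the ONE open piece
`LogResDiv`. PROVED. -/
theorem closes (hR : Dominance.RegularRoofs) (hP : Dominance.ProperReduction) (hG : Dominance.IdealsAreSumsOfDivisors)
    (hM : Dominance.MonomialPrincipalization) (hL : Dominance.LogResDiv) : _root_.ResolutionOfSingularities :=
  Dominance.closes hR (hP (sandwichedResolveProper_of hG hM hL))

/-- **`closes_split`**: the ROOT with `LogResDiv` replaced by its split `EmbDesingDiv ∧ Dominance.EndGameDiv`.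
PROVED. -/
theorem closes_split (hR : Dominance.RegularRoofs) (hP : Dominance.ProperReduction)
    (hG : Dominance.IdealsAreSumsOfDivisors) (hM : Dominance.MonomialPrincipalization) (hE : Dominance.EmbDesingDiv)
    (hF : Dominance.EndGameDiv) : _root_.ResolutionOfSingularities :=
  closes hR hP hG hM (logResDiv_of_embDesing_endGame hE hF)

/-- **`closes_nagata`**: the ROOT with the Nagata step discharged by the tree's named Literature
fact `NagataCompactification` (Conrad 2007 / Deligne; Stacks 0F41) instead of the support piece
`ProperReduction`. PROVED. -/
theorem closes_nagata (hR : Dominance.RegularRoofs) (hN : NagataCompactification.{0})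
    (hG : Dominance.IdealsAreSumsOfDivisors) (hM : Dominance.MonomialPrincipalization) (hL : Dominance.LogResDiv) :
    _root_.ResolutionOfSingularities :=
  closes hR (properReduction_of_nagata hN) hG hM hL


end Summit.ResolutionOfSingularities.ResolutionOfSingularities.Theorems.DominanceDivisorCut

end
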